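import Literature.RepresentationTheory.FiniteGroups.CosetKernelModule
import HarnessLib

/-!
# The coset-kernel criterion along a surjection `π : Γ → G`: `Hom_Γ(A, C(G; H ≤ H′)) = 0 ⟺ every
# `π⁻¹H`-invariant character of `A` is `π⁻¹H′`-invariant` (Frobenius reciprocity; no named fact)

Topic `RepresentationTheory/FiniteGroups` (namespace = path).  THEOREM-ONLY file (no definition, no named fact, no `sorry`),
written by the prover seat `bsd-potss-k8t-c4` g25 (cell `bsd-potss`; `--supports` stmt-BirchSwinnertonDyer-19982; closes nothing).
Sequel of `CosetKernelModule.lean` (same seat): there the group `G` carrying the coset kernel `C = cosetKernel H H′ R` acts on `A`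
itself (`ρ : G → End A`); here `A` is acted on by a bigger group `Γ` through `ρ : Γ → End A`, and `C` is a `Γ`-module through a
SURJECTION `π : Γ → G` with a set-theoretic section `s` (`π (s g) = g`).  Characters `ν : A → R` are «`H`-invariant» when
`ν(ρ(τ) a) = ν(a)` for all `τ ∈ π⁻¹(H)` (in particular for `τ ∈ ker π`), and `μ : A → C` is equivariant when `μ(ρ(τ) a) = π(τ) • μ(a)`.

* `equivariantHom_eq_zero_of_forall_invariant_lift` — if every `H`-invariant character is `H′`-invariant then every equivariant
  `μ : A → C` vanishes (`#H′` injective on `R`);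
* `invariant_lift_of_forall_equivariantHom_eq_zero` — conversely (`H ≤ H′`, `u • #H′ = 1` on `R`), using the `H′`-average
  `ν′(b) = u • Σ_{h′ ∈ H′} ν(ρ(s h′)⁻¹ b)` (independent of the section because `ν` is `ker π`-invariant);
* `eq_zero_of_forall_smul_eq_of_transitive` — `C^S = 0` for any `S ⊆ G` with `S·H = G` (an `S`-fixed member of `C` is constant,
  and a coset sum kills it) — the form in which the cell discharges hypothesis (c3*-I) of the equivariant Iwasawa lemma
  (`NumberFields/EquivariantIwasawaLemmaInertia.lean`) from «the inertia group acts transitively on `G/H`».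

This is the shape in which the cell's rank-equality transfer door meets the layers `L₀K_n` of a cyclotomic tower:
`Γ = Gal(k̄/K_n)` acts on `A = Cl(L₀K_n)` and maps onto `G = Gal(L₀/k)` (restriction), while `C(G; H ≤ H′)` stays a fixed
`G`-module for all `n`.

## References

J.-P. Serre, *Linear Representations of Finite Groups*, GTM 42, §3.3 Example 2, §7.2 Thm. 13 (Frobenius reciprocity).
[SerreLinearRepresentations1977]
-/

noncomputable section

open scoped BigOperators

namespace Literature.RepresentationTheory.FiniteGroups

variable {G : Type*} [Group G] (H H' : Subgroup G) (R : Type*) [AddCommGroup R] [Fintype H']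

/-- **`C^S = 0` for `S ⊆ G` with `S · H = G`**: an element of the coset kernel fixed by every `s ∈ S` is constant
(`f(s h) = f(s) = f(1)`), and the coset sum at `1` gives `#H′ • f(1) = 0`.
[cite: SerreLinearRepresentations1977, §7.2 Thm. 13 (Frobenius reciprocity)] -/
theorem eq_zero_of_forall_smul_eq_of_transitive (hH' : ∀ r : R, Fintype.card H' • r = 0 → r = 0) (S : Set G)
    (hSH : ∀ g : G, ∃ s ∈ S, ∃ h ∈ H, g = s * h) (f : cosetKernel H H' R) (hf : ∀ s ∈ S, s • f = f) : f = 0 := by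
  have hconst : ∀ x : G, f.1 x = f.1 1 := fun x => by
    obtain ⟨s, hs, h, hh, rfl⟩ := hSH x
    have h1 := congrArg (fun φ : cosetKernel H H' R => φ.1 (s * h)) (hf s hs)
    simp only [coe_smul_apply, inv_mul_cancel_left] at h1
    -- `h1 : f h = f (s * h)`
    rw [← h1]
    have h2 := f.2.1 1 h hh
    rw [one_mul] at h2
    exact h2
  have hsum := f.2.2 1
  simp only [one_mul, hconst, Finset.sum_const, Finset.card_univ] at hsum
  have h1 : f.1 1 = 0 := hH' _ hsum
  ext x
  rw [hconst x, h1]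
  rfl

section Lift

variable {Γ : Type*} [Group Γ] (π : Γ →* G) {A : Type*} [AddCommGroup A] (ρ : Γ →* AddMonoid.End A)

/-- `ρ(τ τ′) a = ρ(τ) (ρ(τ′) a)`. [folklore] -/
private theorem rho_mul_apply' (τ τ' : Γ) (a : A) : ρ (τ * τ') a = ρ τ (ρ τ' a) := by
  rw [map_mul]; rfl

/-- `ρ(1) a = a`. [folklore] -/
private theorem rho_one_apply' (a : A) : ρ 1 a = a := by
  rw [map_one]; rfl

/-- `ker π`-invariance inside: `ν(ρ(τ) a) = ν(ρ(τ′) a)` whenever `π τ = π τ′` and `ν` is invariant under `π⁻¹(H) ⊇ ker π`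
(acting outermost). [folklore] -/
private theorem apply_eq_of_pi_eq (ν : A →+ R) (hν : ∀ τ : Γ, π τ ∈ H → ∀ a : A, ν (ρ τ a) = ν a)
    {τ τ' : Γ} (h : π τ = π τ') (a : A) : ν (ρ τ a) = ν (ρ τ' a) := by
  have hk : π (τ * τ'⁻¹) ∈ H := by
    rw [map_mul, map_inv, h, mul_inv_cancel]
    exact H.one_mem
  have h1 := hν (τ * τ'⁻¹) hk (ρ τ' a)
  rw [← rho_mul_apply', inv_mul_cancel_right] at h1
  exact h1

/-- **If every `π⁻¹H`-invariant character `A → R` is `π⁻¹H′`-invariant, then every `Γ`-equivariant additive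
`μ : A → C(G; H ≤ H′)` vanishes** (`π : Γ → G` onto, `#H′` injective on `R`): `ν = ev₁ ∘ μ` is `π⁻¹H`-invariant, hence
`π⁻¹H′`-invariant, and `μ(a)(π τ) = ν(ρ(τ)⁻¹ a)` has coset sums `#H′ • ν(…) = 0`.
[cite: SerreLinearRepresentations1977, §7.2 Thm. 13 (Frobenius reciprocity)] -/
theorem equivariantHom_eq_zero_of_forall_invariant_lift (hπ : Function.Surjective π)
    (hH' : ∀ r : R, Fintype.card H' • r = 0 → r = 0)
    (hfix : ∀ ν : A →+ R, (∀ τ : Γ, π τ ∈ H → ∀ a : A, ν (ρ τ a) = ν a) →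
      ∀ τ : Γ, π τ ∈ H' → ∀ a : A, ν (ρ τ a) = ν a)
    (μ : A →+ cosetKernel H H' R) (hμ : ∀ (τ : Γ) (a : A), μ (ρ τ a) = π τ • μ a) : μ = 0 := by
  let ν : A →+ R :=
    { toFun := fun a => (μ a).1 1
      map_zero' := by rw [map_zero]; rfl
      map_add' := fun a b => by rw [map_add]; rfl }
  have hνapp : ∀ a : A, ν a = (μ a).1 1 := fun a => rfl
  -- `μ(a)(π τ) = ν(ρ τ⁻¹ a)`
  have hμν : ∀ (a : A) (τ : Γ), (μ a).1 (π τ) = ν (ρ τ⁻¹ a) := fun a τ => by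
    rw [hνapp, hμ, map_inv, coe_smul_apply, inv_inv, mul_one]
  -- `ν` is `π⁻¹H`-invariant, hence `π⁻¹H′`-invariant
  have hνH : ∀ τ : Γ, π τ ∈ H → ∀ a : A, ν (ρ τ a) = ν a := fun τ hτ a => by
    rw [hνapp, hνapp, hμ, coe_smul_apply, mul_one]
    have h1 := (μ a).2.1 1 (π τ)⁻¹ (H.inv_mem hτ)
    rw [one_mul] at h1
    exact h1
  have hνH' := hfix ν hνH
  refine AddMonoidHom.ext fun a => Subtype.ext (funext fun g => ?_)
  obtain ⟨τ, rfl⟩ := hπ g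
  have hsum := (μ a).2.2 (π τ)
  have hterm : ∀ h' : H', (μ a).1 (π τ * (h' : G)) = ν (ρ τ⁻¹ a) := fun h' => by
    obtain ⟨σ, hσ⟩ := hπ (h' : G)
    rw [← hσ, ← map_mul, hμν, mul_inv_rev, rho_mul_apply', hνH' _ (by rw [map_inv, hσ]; exact H'.inv_mem h'.2)]
  simp only [hterm, Finset.sum_const, Finset.card_univ] at hsum
  rw [hμν]
  exact hH' _ hsum

/-- `Σ_{h′ ∈ H′} ν(ρ(s h′)⁻¹ ρ(τ) a) = Σ_{h′ ∈ H′} ν(ρ(s h′)⁻¹ a)` for `π τ ∈ H′` (reindex `h′ ↦ (π τ)⁻¹h′`; the section `s` only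
matters up to `ker π`, under which `ν` is invariant). [folklore] -/
private theorem sum_comp_mem_lift (s : G → Γ) (hs : ∀ g : G, π (s g) = g) (ν : A →+ R)
    (hν : ∀ τ : Γ, π τ ∈ H → ∀ a : A, ν (ρ τ a) = ν a) {τ : Γ} (hτ : π τ ∈ H') (a : A) :
    ∑ h' : H', ν (ρ (s h')⁻¹ (ρ τ a)) = ∑ h' : H', ν (ρ (s h')⁻¹ a) := by
  have key : ∀ h' : H', ν (ρ (s h')⁻¹ (ρ τ a)) =
      ν (ρ (s (((⟨(π τ)⁻¹, H'.inv_mem hτ⟩ : H') * h' : H') : G))⁻¹ a) := fun h' => by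
    rw [← rho_mul_apply']
    refine apply_eq_of_pi_eq H R π ρ ν hν ?_ a
    rw [map_mul, map_inv, hs, map_inv, hs]
    change (h' : G)⁻¹ * π τ = ((π τ)⁻¹ * (h' : G))⁻¹
    rw [mul_inv_rev, inv_inv]
  simp_rw [key]
  exact Fintype.sum_equiv (Equiv.mulLeft (⟨(π τ)⁻¹, H'.inv_mem hτ⟩ : H')) _ _ fun _ => rfl

/-- **If every `Γ`-equivariant additive `μ : A → C(G; H ≤ H′)` vanishes, then every `π⁻¹H`-invariant character `ν : A → R`
is `π⁻¹H′`-invariant** (`H ≤ H′`, `π` onto with a section `s`, `u • #H′ = 1` on `R`): the map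
`μ_ν(a)(g) = ν(ρ(s g)⁻¹ a) − ν′(ρ(s g)⁻¹ a)`, `ν′` the `H′`-average along `s`, is equivariant into the coset kernel.
[cite: SerreLinearRepresentations1977, §7.2 Thm. 13 (Frobenius reciprocity)] -/
theorem invariant_lift_of_forall_equivariantHom_eq_zero (hHH' : H ≤ H') (s : G → Γ) (hs : ∀ g : G, π (s g) = g)
    (u : ℤ) (hu : ∀ r : R, u • (Fintype.card H' • r) = r)
    (hvan : ∀ μ : A →+ cosetKernel H H' R, (∀ (τ : Γ) (a : A), μ (ρ τ a) = π τ • μ a) → μ = 0)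
    (ν : A →+ R) (hν : ∀ τ : Γ, π τ ∈ H → ∀ a : A, ν (ρ τ a) = ν a) :
    ∀ τ : Γ, π τ ∈ H' → ∀ a : A, ν (ρ τ a) = ν a := by
  -- `ν(ρ x a)` only depends on `π x`
  have hwd : ∀ {x y : Γ}, π x = π y → ∀ a : A, ν (ρ x a) = ν (ρ y a) := fun h a => apply_eq_of_pi_eq H R π ρ ν hν h a
  -- the average
  let ν' : A → R := fun b => u • ∑ h' : H', ν (ρ (s h')⁻¹ b)
  have hν'def : ∀ b, ν' b = u • ∑ h' : H', ν (ρ (s h')⁻¹ b) := fun b => rfl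
  have hν'inv : ∀ τ : Γ, π τ ∈ H' → ∀ b : A, ν' (ρ τ b) = ν' b := fun τ hτ b => by
    rw [hν'def, hν'def, sum_comp_mem_lift H H' R π ρ s hs ν hν hτ]
  have hν'add : ∀ b c : A, ν' (b + c) = ν' b + ν' c := fun b c => by
    rw [hν'def, hν'def, hν'def, ← smul_add, ← Finset.sum_add_distrib]
    congr 1
    exact Finset.sum_congr rfl fun h' _ => by rw [map_add, map_add]
  have hν'zero : ν' 0 = 0 := by
    rw [hν'def]
    have hterm0 : ∀ h' : H', ν (ρ (s h')⁻¹ 0) = 0 := fun h' => by rw [map_zero, map_zero]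
    simp only [hterm0, Finset.sum_const_zero, smul_zero]
  -- the map `μ_ν`
  let μ : A →+ cosetKernel H H' R :=
    { toFun := fun a => ⟨fun g => ν (ρ (s g)⁻¹ a) - ν' (ρ (s g)⁻¹ a), by
        refine ⟨fun g h hh => ?_, fun g => ?_⟩
        · change ν (ρ (s (g * h))⁻¹ a) - ν' (ρ (s (g * h))⁻¹ a) = ν (ρ (s g)⁻¹ a) - ν' (ρ (s g)⁻¹ a)
          -- `s (g h) ≡ s g · s h (mod ker π)`
          have e1 : π ((s (g * h))⁻¹) = π ((s h)⁻¹ * (s g)⁻¹) := by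
            rw [map_inv, hs, map_mul, map_inv, map_inv, hs, hs, mul_inv_rev]
          have e2 : ∀ b : A, ν' (ρ (s (g * h))⁻¹ b) = ν' (ρ ((s h)⁻¹ * (s g)⁻¹) b) := fun b => by
            rw [hν'def, hν'def]
            congr 1
            refine Finset.sum_congr rfl fun h' _ => ?_
            rw [← rho_mul_apply', ← rho_mul_apply']
            exact hwd (by rw [map_mul, map_mul, e1]) b
          rw [hwd e1, e2, rho_mul_apply', hν _ (by rw [map_inv, hs]; exact H.inv_mem hh),
            hν'inv _ (by rw [map_inv, hs]; exact H'.inv_mem (hHH' hh))]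
        · change ∑ h' : H', (ν (ρ (s (g * (h' : G)))⁻¹ a) - ν' (ρ (s (g * (h' : G)))⁻¹ a)) = 0
          have hterm : ∀ h' : H', ν (ρ (s (g * (h' : G)))⁻¹ a) - ν' (ρ (s (g * (h' : G)))⁻¹ a) =
              ν (ρ (s h')⁻¹ (ρ (s g)⁻¹ a)) - ν' (ρ (s g)⁻¹ a) := fun h' => by
            have e1 : π ((s (g * h'))⁻¹) = π ((s h')⁻¹ * (s g)⁻¹) := by
              rw [map_inv, hs, map_mul, map_inv, map_inv, hs, hs, mul_inv_rev]
            have e2 : ∀ b : A, ν' (ρ (s (g * h'))⁻¹ b) = ν' (ρ ((s h')⁻¹ * (s g)⁻¹) b) := fun b => by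
              rw [hν'def, hν'def]
              congr 1
              refine Finset.sum_congr rfl fun h'' _ => ?_
              rw [← rho_mul_apply', ← rho_mul_apply']
              exact hwd (by rw [map_mul, map_mul, e1]) b
            rw [hwd e1, e2, rho_mul_apply', hν'inv _ (by rw [map_inv, hs]; exact H'.inv_mem h'.2)]
          simp only [hterm, Finset.sum_sub_distrib, Finset.sum_const, Finset.card_univ]
          rw [hν'def (ρ (s g)⁻¹ a), smul_comm, hu, sub_self]⟩
      map_zero' := Subtype.ext (funext fun g => by
        change ν (ρ (s g)⁻¹ 0) - ν' (ρ (s g)⁻¹ 0) = 0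
        rw [map_zero, map_zero, hν'zero, sub_zero])
      map_add' := fun a b => Subtype.ext (funext fun g => by
        change ν (ρ (s g)⁻¹ (a + b)) - ν' (ρ (s g)⁻¹ (a + b)) =
          (ν (ρ (s g)⁻¹ a) - ν' (ρ (s g)⁻¹ a)) + (ν (ρ (s g)⁻¹ b) - ν' (ρ (s g)⁻¹ b))
        rw [map_add, map_add, hν'add]
        abel) }
  have hμapp : ∀ (a : A) (g : G), (μ a).1 g = ν (ρ (s g)⁻¹ a) - ν' (ρ (s g)⁻¹ a) := fun a g => rfl
  have hμeq : ∀ (τ : Γ) (a : A), μ (ρ τ a) = π τ • μ a := fun τ a =>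
    Subtype.ext (funext fun g => by
      rw [hμapp, coe_smul_apply, hμapp, ← rho_mul_apply']
      have e1 : π ((s g)⁻¹ * τ) = π (s ((π τ)⁻¹ * g))⁻¹ := by
        rw [map_mul, map_inv, hs, map_inv, hs, mul_inv_rev, inv_inv]
      rw [hwd e1]
      congr 1
      rw [hν'def, hν'def]
      congr 1
      refine Finset.sum_congr rfl fun h' _ => ?_
      rw [← rho_mul_apply', ← rho_mul_apply']
      exact hwd (by rw [map_mul π ((s (h' : G))⁻¹), map_mul π ((s (h' : G))⁻¹), e1]) a)
  have h0 := hvan μ hμeq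
  have hνν' : ∀ a : A, ν a = ν' a := fun a => by
    have h := congrArg (fun φ : A →+ cosetKernel H H' R => (φ a).1 1) h0
    rw [AddMonoidHom.zero_apply, hμapp] at h
    have e1 : π (s 1)⁻¹ = π 1 := by rw [map_inv, hs, inv_one, map_one]
    have e2 : ν' (ρ (s 1)⁻¹ a) = ν' a := by
      rw [hν'def, hν'def]
      congr 1
      refine Finset.sum_congr rfl fun h' _ => ?_
      rw [← rho_mul_apply']
      have h3 := hwd (x := (s h')⁻¹ * (s 1)⁻¹) (y := (s h')⁻¹) (by rw [map_mul, e1, map_one, mul_one]) a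
      exact h3
    rw [hwd e1, rho_one_apply', e2] at h
    exact sub_eq_zero.mp (h.trans rfl)
  intro τ hτ a
  rw [hνν', hνν' a]
  exact hν'inv τ hτ a

end Lift

section Saturated

variable {G : Type*} [Group G] (H H' : Subgroup G) (R : Type*) [AddCommGroup R] [Fintype H']

/-- **`C^S = 0` for a subgroup `S ≤ G` whose orbits on `G/H` saturate the fibres of `G/H → G/H′`**: if for all `g ∈ G`,
`h′ ∈ H′` one has `g h′ ∈ S g H`, then an `S`-fixed member `f` of the coset kernel is constant on each fibre
(`f(g h′) = f(s g h) = f(g)`), and the coset sum at `g` reads `#H′ • f(g) = 0`.  (The transitive case `S·H = G` of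
`eq_zero_of_forall_smul_eq_of_transitive` and the case `H′ ⊆ H·(S ∩ Z(G))` are instances.)
[cite: SerreLinearRepresentations1977, §7.2 Thm. 13 (Frobenius reciprocity)] -/
theorem eq_zero_of_forall_smul_eq_of_saturated (hH' : ∀ r : R, Fintype.card H' • r = 0 → r = 0) (S : Subgroup G)
    (hsat : ∀ g : G, ∀ h' ∈ H', ∃ s ∈ S, ∃ h ∈ H, g * h' = s * g * h)
    (f : cosetKernel H H' R) (hf : ∀ s ∈ S, s • f = f) : f = 0 := by
  have hSinv : ∀ s ∈ S, ∀ x : G, f.1 (s * x) = f.1 x := fun s hs x => by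
    have h3 := congrArg (fun φ : cosetKernel H H' R => φ.1 (s * x)) (hf s hs)
    simp only [coe_smul_apply, inv_mul_cancel_left] at h3
    exact h3.symm
  have hfib : ∀ (g : G) (h' : H'), f.1 (g * (h' : G)) = f.1 g := fun g h' => by
    obtain ⟨s, hs, h, hh, e⟩ := hsat g h' h'.2
    rw [e, mul_assoc, hSinv s hs, f.2.1 g h hh]
  ext g
  have hsum := f.2.2 g
  simp only [hfib, Finset.sum_const, Finset.card_univ] at hsum
  rw [hH' _ hsum]
  rfl

end Saturated

end Literature.RepresentationTheory.FiniteGroups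

end
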